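import Literature.MathematicalPhysics.QuantumFieldTheory.Balaban1983to89.B6BlockDecayK12V1
import Literature.MathematicalPhysics.QuantumFieldTheory.Balaban1983to89.B6BlockDecayGtV1

/-!
# `Balaban1983to89.B6Prop25DecayTwoScaleV1` — T. Bałaban, *Propagators and renormalization transformations for lattice gauge theories. II*,
# Commun. Math. Phys. **96** (1984) 223–250 [Balaban1984PropagatorsII], PROPOSITION 2.5 p. 246, THE DECAY MEMBER (1.110)₀ FOR THE
# GENUINE TWO-SCALE `G = Δ_a⁻¹` OF (2.90), `Λ′ ⊂ T^{(j+1)}` ARBITRARY, for the concrete data `tsV1` at the paper's scaling — file 7, the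
# assembly of the two-level decay programme

statement-level skeleton of published theorems with citation tags; proofs where landed; nothing here is a claim about the Yang–Mills mass gap

p. 246 (Proposition 2.5, verbatim): *"The operator G defined by (2.90) on the torus T_Ω (or on the whole lattice ξZ^d) has the representation
(2.129) and satisfies all the inequalities (1.110)–(1.114) of the Proposition 1.2 with a positive constant δ₂ instead of δ₀. This constant
depends on d and L only."*  [4] (1.110) p. 35: *"|(GJ)(x)|, … ≤ O(1)e^{−δ₀|y−y′|}|J| for x ∈ Δ̃(y), supp J ⊂ Δ̃(y′), with the constant O(1)
depending on d only"*.

WHAT THIS FILE DOES.  The representation (2.129) as an operator identity (file 1, `…B6Repr2129Operator.G_eq_op_V1`: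
`G = K₁ + (I − K₂)*(G̃_j + H_jC̃^{(j)}_ΛH_j*)(I − K₂)`) and the uniform block bounds of its five ingredients — `K₁`, `K₂`, `K₂*` (file 5,
`…B6BlockDecayK12V1`), `H_jC̃^{(j)}_ΛH_j*` (file 3, `…B6BlockDecayHjCovV1.blockBound_HjCtHj_scaling`), `G̃_j` (file 6,
`…B6BlockDecayGtV1.blockBound_Gt_scaling`, from [4] Prop. 1.2 BY NAME) — are combined by the block calculus of file 2 (`blockBound_add/sub/comp/
id/mono`, no volume factors) into §1 **`blockBound_G_scaling`**: for every dimension `d + 1`, block size `L` and weight window `0 < a₀ ≤ a₁`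
there are `δ₂ > 0`, `C ≥ 0` such that for every volume `(m, K)`, every `j + 1 ≤ m + K`, every `Λ′ ⊂ T^{(j+1)}`, all weights
`a₀n^{d+1} ≤ w ≤ a₁n^{d+1}` ([4]'s `a₀ ≤ a ≤ a₁`), all fine bonds `b₀` and unit sites `y`:
`Σ_{b₀′ : y(b₀′₋) = y} |G(e_{b₀′})_{b₀}| ≤ C·e^{−δ₂|y(b₀₋) − y|_T}`; and §2 THE PRINTED SHAPE (1.110)₀ (file 2's `abs_apply_le_of_support`),
**`prop25_ineq110_0`**: for `J` supported on the fine bonds over the unit sites within `r` of `y′`, `|J| ≤ X`, and every fine bond `b₀` over the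
sites within `r` of `y`: `|(GJ)(b₀)| ≤ C·e^{(1+2δ₂)r}·e^{−δ₂|y − y′|_T}·X` — `r = 0`: blocks `B^j(y)`; `r = 1`: contains [4]'s cubes `Δ̃(y)`.

HONEST SCOPE / DIVERGENCES. (1) Only the member `|(GJ)(x)|` of (1.110) (the sup/decay bound of `G` itself); the members `∇GJ`, `G∇*J`, `ΔGJ`
and (1.111)–(1.114) are not treated here. (2) The paper's scaling `c = η⁻¹ = L^j`; weights in [4]'s window (as everywhere in the V1 lineage,
the tree's `G_j` has `a = 1`, immaterial by file 1's weight freedom). (3) `C, δ₂` depend on `d, L, a₀, a₁` only — *"This constant depends on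
d and L only"* (the weight window being fixed). (4) The torus `T^{(0)}` of the model (`Setup`), not `ξℤ^d`. (5) No new definition, no new
hypothesis: files 1–6 and [4] Prop. 1.2 (p19's `prop12Printed_allTori_allScales`) BY NAME.  NOT summit progress.
Unit `lit-balaban-p22` (gen 14), 2026-08-22.
-/

noncomputable section

open scoped InnerProductSpace BigOperators
open Finset

namespace Literature.MathematicalPhysics.QuantumFieldTheory.Balaban1983to89.B6Prop25DecayTwoScaleV1

open LatticeFieldCalculus B5SectBStatements B5Eq117TorusCarriers B6SectAOperatorsV1 B6SectCOperators
  B6SectCTwoScaleV1 B6SectCTwoScaleV1Lattice B5Eq118OneStroke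
open BalabanImbrieJaffe1984to88.BIJ85AxialPropagator411 (BondSpace)
open B4Sect5Torus (IsPseudoDist SumBound)
open B4TorusKernel.MultiPeriod (torusSupNorm torusSupNorm_nonneg)
open B4Sect5Proof (latticeConst latticeConst_nonneg)
open B6LowerBound2153Torus (rep)
open B6Repr2129Operator (G_eq_op_V1)
open B6BlockDecayCalculus (blockBound_comp blockBound_add blockBound_sub blockBound_id blockBound_mono abs_apply_le_of_support
  torusDist_isPseudoDist torusDist_sumBound)
open B6BlockDecayHjCovV1 (blockBound_HjCtHj_scaling)
open B6BlockDecayK12V1 (blockBound_K1_scaling blockBound_K2_scaling blockBound_K2adj_scaling)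
open B6BlockDecayGtV1 (blockBound_Gt_scaling)

variable {d L m K : ℕ} {hd : 1 ≤ d + 1} {hL : Odd L ∧ 1 < L} {j : ℕ}

/-! ## §1  The block bound of `G`: Proposition 2.5, (1.110)₀, uniformly in the volume, `j`, `Λ′` and the weight window -/

open Classical in
/-- **PROPOSITION 2.5, THE DECAY OF THE TWO-SCALE `G` AS A BLOCK BOUND** (at `c = L^j`, weights `a₀n^{d+1} ≤ w ≤ a₁n^{d+1}`): there are `δ₂ > 0`,
`C ≥ 0` depending on `d, L, a₀, a₁` only such that for every volume `(m, K)`, every `j + 1 ≤ m + K`, every `Λ′ ⊂ T^{(j+1)}`, all weights in the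
window and all fine bonds `b₀`, unit sites `y`: `Σ_{b₀′ : y(b₀′₋) = y}|G(e_{b₀′})_{b₀}| ≤ C·e^{−δ₂|y(b₀₋) − y|_T}` — (2.129)
`G = K₁ + (I − K₂)*(G̃_j + H_jC̃^{(j)}_ΛH_j*)(I − K₂)` with the five uniform block bounds of files 3, 5, 6, composed by file 2 (rates halved at
each composition). [cite: Balaban1984PropagatorsII, Prop. 2.5 p.246] -/
theorem blockBound_G_scaling (d L : ℕ) (hd : 1 ≤ d + 1) (hL : Odd L ∧ 1 < L) {a₀ a₁ : ℝ} (ha₀ : 0 < a₀) (ha₁ : a₀ ≤ a₁) :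
    ∃ δ : ℝ, 0 < δ ∧ ∃ C : ℝ, 0 ≤ C ∧ ∀ (m K : ℕ) (j : ℕ) (hc : ((L : ℝ) ^ j) ≠ 0)
      (_hj : j + 1 ≤ (⟨d + 1, L, m, K, hd, hL⟩ : Params).m + (⟨d + 1, L, m, K, hd, hL⟩ : Params).K)
      (Λ' : Finset (Site (⟨d + 1, L, m, K, hd, hL⟩ : Params) (j + 1))) (w : CIdx j Λ' → ℝ)
      (_hw0 : ∀ i, a₀ * ((L : ℝ) ^ j) ^ (d + 1) ≤ w i) (_hw1 : ∀ i, w i ≤ a₁ * ((L : ℝ) ^ j) ^ (d + 1))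
      (b₀ : PBond (⟨d + 1, L, m, K, hd, hL⟩ : Params) 0) (y : Site (⟨d + 1, L, m, K, hd, hL⟩ : Params) j),
      ∑ b₀' ∈ univ.filter (fun b₀' : PBond (⟨d + 1, L, m, K, hd, hL⟩ : Params) 0 => iterBlockOf j b₀'.src = y),
          |(tsV1 hc Λ' w).G (EuclideanSpace.single b₀' (1 : ℝ)) b₀| ≤
        C * Real.exp (-(δ * torusSupNorm (Mk (⟨d + 1, L, m, K, hd, hL⟩ : Params) j)
            (rep (Mk (⟨d + 1, L, m, K, hd, hL⟩ : Params) j) (iterBlockOf j b₀.src) - rep (Mk (⟨d + 1, L, m, K, hd, hL⟩ : Params) j) y))) := by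
  obtain ⟨δ₁, hδ₁, C₁, hC₁, hK1⟩ := blockBound_K1_scaling d L hd hL
  obtain ⟨δ₂, hδ₂, C₂, hC₂, hK2⟩ := blockBound_K2_scaling d L hd hL
  obtain ⟨δ₃, hδ₃, C₃, hC₃, hK2a⟩ := blockBound_K2adj_scaling d L hd hL
  obtain ⟨δ₄, hδ₄, C₄, hC₄, hHCH⟩ := blockBound_HjCtHj_scaling d L hd hL ha₀ ha₁
  obtain ⟨δ₅, hδ₅, C₅, hC₅, hGt⟩ := blockBound_Gt_scaling d L hd hL
  -- the common rate and the halvings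
  set δ₀ : ℝ := min (min (min δ₁ δ₂) (min δ₃ δ₄)) δ₅ with hδ₀
  have hδ₀0 : 0 < δ₀ := lt_min (lt_min (lt_min hδ₁ hδ₂) (lt_min hδ₃ hδ₄)) hδ₅
  have h01 : δ₀ ≤ δ₁ := (min_le_left _ _).trans ((min_le_left _ _).trans (min_le_left _ _))
  have h02 : δ₀ ≤ δ₂ := (min_le_left _ _).trans ((min_le_left _ _).trans (min_le_right _ _))
  have h03 : δ₀ ≤ δ₃ := (min_le_left _ _).trans ((min_le_right _ _).trans (min_le_left _ _))
  have h04 : δ₀ ≤ δ₄ := (min_le_left _ _).trans ((min_le_right _ _).trans (min_le_right _ _))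
  have h05 : δ₀ ≤ δ₅ := min_le_right _ _
  set Ka : ℝ := latticeConst (d + 1) (δ₀ - δ₀ / 2) with hKa
  set Kb : ℝ := latticeConst (d + 1) (δ₀ - δ₀ / 4) with hKb
  have hKa0 : 0 ≤ Ka := latticeConst_nonneg _ (by linarith)
  have hKb0 : 0 ≤ Kb := latticeConst_nonneg _ (by linarith)
  set C : ℝ := C₁ + (1 + C₃) * ((C₅ + C₄) * (1 + C₂) * Ka) * Kb with hC
  have hC0 : 0 ≤ C := by positivity
  refine ⟨δ₀ / 4, by positivity, C, hC0, ?_⟩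
  intro m K j hc hj Λ' w hw0 hw1 b₀ y
  have hL0 : 0 < L := by have := hL.2; omega
  have hLp : (0 : ℝ) < L := by exact_mod_cast hL0
  have hw : ∀ i, 0 < w i := fun i => lt_of_lt_of_le (by positivity) (hw0 i)
  have hρ : IsPseudoDist (fun t t' : Site (⟨d + 1, L, m, K, hd, hL⟩ : Params) j => torusSupNorm (Mk (⟨d + 1, L, m, K, hd, hL⟩ : Params) j)
      (rep (Mk (⟨d + 1, L, m, K, hd, hL⟩ : Params) j) t - rep (Mk (⟨d + 1, L, m, K, hd, hL⟩ : Params) j) t')) :=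
    torusDist_isPseudoDist (Mk (⟨d + 1, L, m, K, hd, hL⟩ : Params) j)
  have hK : SumBound (fun t t' : Site (⟨d + 1, L, m, K, hd, hL⟩ : Params) j => torusSupNorm (Mk (⟨d + 1, L, m, K, hd, hL⟩ : Params) j)
      (rep (Mk (⟨d + 1, L, m, K, hd, hL⟩ : Params) j) t - rep (Mk (⟨d + 1, L, m, K, hd, hL⟩ : Params) j) t')) (fun a => latticeConst (d + 1) a) :=
    torusDist_sumBound (Mk (⟨d + 1, L, m, K, hd, hL⟩ : Params) j)
  -- (a) the five ingredient bounds, at the common rate `δ₀`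
  have b1 := blockBound_mono hρ (tsV1 hc Λ' w).K1 (fun b₀ : PBond (⟨d + 1, L, m, K, hd, hL⟩ : Params) 0 => iterBlockOf j b₀.src)
    (fun b₀ : PBond (⟨d + 1, L, m, K, hd, hL⟩ : Params) 0 => iterBlockOf j b₀.src) hC₁ le_rfl (show δ₀ / 4 ≤ δ₁ by linarith)
    (hK1 m K j hc hj Λ' w hw)
  have b2 := blockBound_mono hρ (tsV1 hc Λ' w).K2 (fun b₀ : PBond (⟨d + 1, L, m, K, hd, hL⟩ : Params) 0 => iterBlockOf j b₀.src)
    (fun b₀ : PBond (⟨d + 1, L, m, K, hd, hL⟩ : Params) 0 => iterBlockOf j b₀.src) hC₂ le_rfl h02 (hK2 m K j hc hj Λ' w hw)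
  have b3 := blockBound_mono hρ (LinearMap.adjoint (tsV1 hc Λ' w).K2) (fun b₀ : PBond (⟨d + 1, L, m, K, hd, hL⟩ : Params) 0 => iterBlockOf j b₀.src)
    (fun b₀ : PBond (⟨d + 1, L, m, K, hd, hL⟩ : Params) 0 => iterBlockOf j b₀.src) hC₃ le_rfl h03 (hK2a m K j hc hj Λ' w hw)
  have b4 := blockBound_mono hρ ((tsV1 hc Λ' w).Hj ∘ₗ (tsV1 hc Λ' w).Ct ∘ₗ LinearMap.adjoint (tsV1 hc Λ' w).Hj)
    (fun b₀ : PBond (⟨d + 1, L, m, K, hd, hL⟩ : Params) 0 => iterBlockOf j b₀.src)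
    (fun b₀ : PBond (⟨d + 1, L, m, K, hd, hL⟩ : Params) 0 => iterBlockOf j b₀.src) hC₄ le_rfl h04 (hHCH m K j hc hj Λ' w hw0 hw1)
  have b5 := blockBound_mono hρ (tsV1 hc Λ' w).Gt (fun b₀ : PBond (⟨d + 1, L, m, K, hd, hL⟩ : Params) 0 => iterBlockOf j b₀.src)
    (fun b₀ : PBond (⟨d + 1, L, m, K, hd, hL⟩ : Params) 0 => iterBlockOf j b₀.src) hC₅ le_rfl h05 (hGt m K j hc hj Λ' w hw)
  have bid := blockBound_id hρ (fun b₀ : PBond (⟨d + 1, L, m, K, hd, hL⟩ : Params) 0 => iterBlockOf j b₀.src) δ₀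
  -- (b) `I − K₂`, `(I − K₂)* = I − K₂*`, `G̃_j + H_jC̃H_j*`
  have bIK2 := blockBound_sub (ρ := (fun t t' : Site (⟨d + 1, L, m, K, hd, hL⟩ : Params) j => torusSupNorm (Mk (⟨d + 1, L, m, K, hd, hL⟩ : Params) j)
      (rep (Mk (⟨d + 1, L, m, K, hd, hL⟩ : Params) j) t - rep (Mk (⟨d + 1, L, m, K, hd, hL⟩ : Params) j) t'))) _ _
    (fun b₀ : PBond (⟨d + 1, L, m, K, hd, hL⟩ : Params) 0 => iterBlockOf j b₀.src)
    (fun b₀ : PBond (⟨d + 1, L, m, K, hd, hL⟩ : Params) 0 => iterBlockOf j b₀.src) bid b2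
  have hadj : LinearMap.adjoint (LinearMap.id - (tsV1 hc Λ' w).K2) = LinearMap.id - LinearMap.adjoint (tsV1 hc Λ' w).K2 := by
    rw [map_sub, LinearMap.adjoint_id]
  have bIK2a := blockBound_sub (ρ := (fun t t' : Site (⟨d + 1, L, m, K, hd, hL⟩ : Params) j => torusSupNorm (Mk (⟨d + 1, L, m, K, hd, hL⟩ : Params) j)
      (rep (Mk (⟨d + 1, L, m, K, hd, hL⟩ : Params) j) t - rep (Mk (⟨d + 1, L, m, K, hd, hL⟩ : Params) j) t'))) _ _
    (fun b₀ : PBond (⟨d + 1, L, m, K, hd, hL⟩ : Params) 0 => iterBlockOf j b₀.src)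
    (fun b₀ : PBond (⟨d + 1, L, m, K, hd, hL⟩ : Params) 0 => iterBlockOf j b₀.src) bid b3
  rw [← hadj] at bIK2a
  have bmid := blockBound_add (ρ := (fun t t' : Site (⟨d + 1, L, m, K, hd, hL⟩ : Params) j => torusSupNorm (Mk (⟨d + 1, L, m, K, hd, hL⟩ : Params) j)
      (rep (Mk (⟨d + 1, L, m, K, hd, hL⟩ : Params) j) t - rep (Mk (⟨d + 1, L, m, K, hd, hL⟩ : Params) j) t'))) _ _
    (fun b₀ : PBond (⟨d + 1, L, m, K, hd, hL⟩ : Params) 0 => iterBlockOf j b₀.src)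
    (fun b₀ : PBond (⟨d + 1, L, m, K, hd, hL⟩ : Params) 0 => iterBlockOf j b₀.src) b5 b4
  -- (c) the two compositions (rates `δ₀/2`, `δ₀/4`) and the sum with `K₁`
  have binner := blockBound_comp hρ hK ((tsV1 hc Λ' w).Gt + (tsV1 hc Λ' w).Hj ∘ₗ (tsV1 hc Λ' w).Ct ∘ₗ LinearMap.adjoint (tsV1 hc Λ' w).Hj)
    (LinearMap.id - (tsV1 hc Λ' w).K2)
    (fun b₀ : PBond (⟨d + 1, L, m, K, hd, hL⟩ : Params) 0 => iterBlockOf j b₀.src) (fun b₀ : PBond (⟨d + 1, L, m, K, hd, hL⟩ : Params) 0 => iterBlockOf j b₀.src)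
    (fun b₀ : PBond (⟨d + 1, L, m, K, hd, hL⟩ : Params) 0 => iterBlockOf j b₀.src)
    (Cf := C₅ + C₄) (Cg := 1 + C₂) (by positivity) (by positivity)
    (show (0 : ℝ) ≤ δ₀ / 2 by positivity) (show δ₀ / 2 ≤ δ₀ by linarith) (show δ₀ / 2 < δ₀ by linarith) bmid bIK2
  have bouter := blockBound_comp hρ hK (LinearMap.adjoint (LinearMap.id - (tsV1 hc Λ' w).K2))
    (((tsV1 hc Λ' w).Gt + (tsV1 hc Λ' w).Hj ∘ₗ (tsV1 hc Λ' w).Ct ∘ₗ LinearMap.adjoint (tsV1 hc Λ' w).Hj) ∘ₗ (LinearMap.id - (tsV1 hc Λ' w).K2))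
    (fun b₀ : PBond (⟨d + 1, L, m, K, hd, hL⟩ : Params) 0 => iterBlockOf j b₀.src) (fun b₀ : PBond (⟨d + 1, L, m, K, hd, hL⟩ : Params) 0 => iterBlockOf j b₀.src)
    (fun b₀ : PBond (⟨d + 1, L, m, K, hd, hL⟩ : Params) 0 => iterBlockOf j b₀.src)
    (Cf := 1 + C₃) (Cg := (C₅ + C₄) * (1 + C₂) * Ka) (by positivity) (by positivity)
    (show (0 : ℝ) ≤ δ₀ / 4 by positivity) (show δ₀ / 4 ≤ δ₀ / 2 by linarith) (show δ₀ / 4 < δ₀ by linarith) bIK2a binner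
  have btot := blockBound_add (ρ := (fun t t' : Site (⟨d + 1, L, m, K, hd, hL⟩ : Params) j => torusSupNorm (Mk (⟨d + 1, L, m, K, hd, hL⟩ : Params) j)
      (rep (Mk (⟨d + 1, L, m, K, hd, hL⟩ : Params) j) t - rep (Mk (⟨d + 1, L, m, K, hd, hL⟩ : Params) j) t'))) _ _
    (fun b₀ : PBond (⟨d + 1, L, m, K, hd, hL⟩ : Params) 0 => iterBlockOf j b₀.src)
    (fun b₀ : PBond (⟨d + 1, L, m, K, hd, hL⟩ : Params) 0 => iterBlockOf j b₀.src) b1 bouter b₀ y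
  rw [G_eq_op_V1 hc hj Λ' hw]
  refine btot.trans (le_of_eq ?_)
  rw [hC, hKb]

/-! ## §2  The printed shape of (1.110)₀: `|(GJ)(x)| ≤ O(1)e^{−δ₂|y − y′|}|J|` -/

open Classical in
/-- **PROPOSITION 2.5, (1.110)₀ IN THE PRINTED SHAPE** for the genuine two-scale `G` of (2.90), `Λ′` arbitrary (at `c = L^j`, weights
`a₀n^{d+1} ≤ w ≤ a₁n^{d+1}`): there are `δ₂ > 0`, `C ≥ 0` depending on `d, L, a₀, a₁` only such that for every volume, `j + 1 ≤ m + K`, `Λ′`, weights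
in the window, every radius `r ≥ 0`, every fine bond field `J` supported on the fine bonds over the unit sites within `r` of `y′` with `|J| ≤ X`, and
every fine bond `b₀` over the unit sites within `r` of `y`: `|(GJ)(b₀)| ≤ C·e^{(1+2δ₂)r}·e^{−δ₂|y − y′|_T}·X` (`r = 0`: the blocks `B^j(y)`,
`B^j(y′)`; `r = 1` contains [4]'s cubes `Δ̃`). *"with a positive constant δ₂ instead of δ₀. This constant depends on d and L only."*
[cite: Balaban1984PropagatorsII, Prop. 2.5 p.246; Balaban1984PropagatorsI, (1.110) p.35] -/
theorem prop25_ineq110_0 (d L : ℕ) (hd : 1 ≤ d + 1) (hL : Odd L ∧ 1 < L) {a₀ a₁ : ℝ} (ha₀ : 0 < a₀) (ha₁ : a₀ ≤ a₁) :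
    ∃ δ : ℝ, 0 < δ ∧ ∃ C : ℝ, 0 ≤ C ∧ ∀ (m K : ℕ) (j : ℕ) (hc : ((L : ℝ) ^ j) ≠ 0)
      (_hj : j + 1 ≤ (⟨d + 1, L, m, K, hd, hL⟩ : Params).m + (⟨d + 1, L, m, K, hd, hL⟩ : Params).K)
      (Λ' : Finset (Site (⟨d + 1, L, m, K, hd, hL⟩ : Params) (j + 1))) (w : CIdx j Λ' → ℝ)
      (_hw0 : ∀ i, a₀ * ((L : ℝ) ^ j) ^ (d + 1) ≤ w i) (_hw1 : ∀ i, w i ≤ a₁ * ((L : ℝ) ^ j) ^ (d + 1))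
      (r : ℝ) (_hr : 0 ≤ r) (J : BondSpace (⟨d + 1, L, m, K, hd, hL⟩ : Params)) (X : ℝ) (_hX : 0 ≤ X)
      (y y' : Site (⟨d + 1, L, m, K, hd, hL⟩ : Params) j)
      (_hsupp : ∀ b : PBond (⟨d + 1, L, m, K, hd, hL⟩ : Params) 0, J b ≠ 0 →
        torusSupNorm (Mk (⟨d + 1, L, m, K, hd, hL⟩ : Params) j)
          (rep (Mk (⟨d + 1, L, m, K, hd, hL⟩ : Params) j) (iterBlockOf j b.src) - rep (Mk (⟨d + 1, L, m, K, hd, hL⟩ : Params) j) y') ≤ r)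
      (_hJ : ∀ b : PBond (⟨d + 1, L, m, K, hd, hL⟩ : Params) 0, |J b| ≤ X)
      (b₀ : PBond (⟨d + 1, L, m, K, hd, hL⟩ : Params) 0)
      (_hb₀ : torusSupNorm (Mk (⟨d + 1, L, m, K, hd, hL⟩ : Params) j)
        (rep (Mk (⟨d + 1, L, m, K, hd, hL⟩ : Params) j) (iterBlockOf j b₀.src) - rep (Mk (⟨d + 1, L, m, K, hd, hL⟩ : Params) j) y) ≤ r),
      |(tsV1 hc Λ' w).G J b₀| ≤
        C * Real.exp ((1 + 2 * δ) * r) * Real.exp (-(δ * torusSupNorm (Mk (⟨d + 1, L, m, K, hd, hL⟩ : Params) j)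
          (rep (Mk (⟨d + 1, L, m, K, hd, hL⟩ : Params) j) y - rep (Mk (⟨d + 1, L, m, K, hd, hL⟩ : Params) j) y'))) * X := by
  obtain ⟨δ, hδ, C, hC, h⟩ := blockBound_G_scaling d L hd hL ha₀ ha₁
  refine ⟨δ, hδ, C * latticeConst (d + 1) 1, mul_nonneg hC (latticeConst_nonneg _ zero_le_one), ?_⟩
  intro m K j hc hj Λ' w hw0 hw1 r hr J X hX y y' hsupp hJ b₀ hb₀
  have hρ : IsPseudoDist (fun t t' : Site (⟨d + 1, L, m, K, hd, hL⟩ : Params) j => torusSupNorm (Mk (⟨d + 1, L, m, K, hd, hL⟩ : Params) j)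
      (rep (Mk (⟨d + 1, L, m, K, hd, hL⟩ : Params) j) t - rep (Mk (⟨d + 1, L, m, K, hd, hL⟩ : Params) j) t')) :=
    torusDist_isPseudoDist (Mk (⟨d + 1, L, m, K, hd, hL⟩ : Params) j)
  have hK : SumBound (fun t t' : Site (⟨d + 1, L, m, K, hd, hL⟩ : Params) j => torusSupNorm (Mk (⟨d + 1, L, m, K, hd, hL⟩ : Params) j)
      (rep (Mk (⟨d + 1, L, m, K, hd, hL⟩ : Params) j) t - rep (Mk (⟨d + 1, L, m, K, hd, hL⟩ : Params) j) t')) (fun a => latticeConst (d + 1) a) :=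
    torusDist_sumBound (Mk (⟨d + 1, L, m, K, hd, hL⟩ : Params) j)
  have h' := abs_apply_le_of_support hρ hK (tsV1 hc Λ' w).G (fun b₀ : PBond (⟨d + 1, L, m, K, hd, hL⟩ : Params) 0 => iterBlockOf j b₀.src)
    (fun b₀ : PBond (⟨d + 1, L, m, K, hd, hL⟩ : Params) 0 => iterBlockOf j b₀.src) hC hδ.le hX (h m K j hc hj Λ' w hw0 hw1) J y y' hsupp hJ b₀ hb₀
  refine h'.trans (le_of_eq ?_)
  ring

end Literature.MathematicalPhysics.QuantumFieldTheory.Balaban1983to89.B6Prop25DecayTwoScaleV1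

end
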